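import Mathlib.MeasureTheory.Integral.MeanInequalities
import Literature.Analysis.FluidPDE.HardSphereDynamics
import Literature.MathematicalPhysics.KineticTheory.HardSphereEuler
import HarnessLib

/-!
# Hölder transfer of an observable along a Liouville-preserving hard-sphere flow (helper, crux 9282)

Crux `Summit.AtomisticToContinuum.HydrodynamicLimit.Theses.AntiMazurCoboundaries.KineticWindowGronwall`
(stmt-AtomisticToContinuum-9282), line `board-node-dock` (lead c6), registered helper stub
`stub_renyiHolderTransfer : RenyiHolderTransfer` of the window-Rényi toolkit
(`Cruxes/KineticWindowGronwall/Lines/board_node_dock_toolkit.lean`; the statement below is the same term as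
`Theorems.KineticWindowGronwallWindowRenyi.RenyiHolderTransfer`).

SETTING. `L` is the Liouville measure of `N+1` hard spheres at reduced density `σ` on `𝕋³`, invariant under the
hard-sphere flow `Φ` (`HardSphereFlow.measurePreserving`); `ψ` is a measurable density w.r.t. `L`, `L`-a.e. nonzero and
never `∞` (the local Gibbs density is such), and `λ = ψ · L` the (NON-invariant) reference law. For every measurable
`H ≥ 0`, time `s` and conjugate exponents `p, q`:
`∫ H (Φ_s z) λ(dz) ≤ (∫ (ψ (Φ_{-s} z) / ψ z) ^ p λ(dz)) ^ {1/p} · (∫ H ^ q dλ) ^ {1/q}`,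
i.e. moving an observable by time `s` under `λ` costs the order-`p` Rényi integral of the transported density.

PROOF (folklore). (a) `∫ H (Φ_s z) d(ψL) = ∫ ψ z · H (Φ_s z) dL` (`lintegral_withDensity_eq_lintegral_mul`);
(b) `L`-a.e. `z` is good (`HardSphereFlow.ae_mem_good`) and there `ψ z = ψ (Φ_{-s} (Φ_s z))`
(`HardSphereFlow.flow_neg_flow`), so the integrand is `G ∘ Φ_s` with `G w = ψ (Φ_{-s} w) · H w`, and invariance
(`MeasurePreserving.lintegral_comp`) gives `∫ G dL`; (c) `L`-a.e. `ψ w ≠ 0, ∞`, so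
`ψ (Φ_{-s} w) = ψ w · (ψ (Φ_{-s} w) / ψ w)` (`ENNReal.mul_div_cancel`) and `∫ G dL = ∫ R · H d(ψL)` with
`R w = ψ (Φ_{-s} w) / ψ w`; (d) Hölder `ENNReal.lintegral_mul_le_Lp_mul_Lq` under `ψL`.
-/

noncomputable section

namespace Summit.AtomisticToContinuum.HydrodynamicLimit.Theorems.KineticWindowGronwallRenyiHolderTransfer

open _root_.MeasureTheory _root_.Set _root_.Filter
open scoped _root_.ENNReal
open Literature.Analysis.FluidPDE Literature.MathematicalPhysics.KineticTheory

/-- The hard-sphere flow of `N+1` spheres at reduced density `σ` on `𝕋³`. -/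
abbrev TFlow (σ : ℝ) (N : ℕ) : Type :=
  HardSphereFlow (Torus.geometry (Fin 3)) (hsDiameter σ N) (N + 1)

/-- The Liouville measure of `N+1` spheres at reduced density `σ` on `𝕋³`. -/
abbrev liou (σ : ℝ) (N : ℕ) : Measure (Config (N + 1) (Fin 3) T3) :=
  liouville (Torus.geometry (Fin 3)) (N + 1) (hsDiameter σ N)

/-- **Helper statement `RenyiHolderTransfer`**: Hölder transfer of an observable along a Liouville-preserving hard-sphere
flow, paid by the order-`p` Rényi integral of the transported density. For a measurable density `ψ` w.r.t. the Liouville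
measure, Liouville-a.e. nonzero and never `∞`, every measurable `H ≥ 0`, time `s` and conjugate exponents `p, q`:
`∫ H(Φ_s z) (ψL)(dz) ≤ (∫ (ψ(Φ_{-s} z)/ψ(z))^p (ψL)(dz))^{1/p} · (∫ H^q d(ψL))^{1/q}`. -/
def RenyiHolderTransfer : Prop :=
  ∀ (σ : ℝ) (N : ℕ) (Φ : TFlow σ N) (ψ : Config (N + 1) (Fin 3) T3 → ℝ≥0∞), Measurable ψ →
    (∀ᵐ z ∂(liou σ N), ψ z ≠ 0) → (∀ z, ψ z ≠ ∞) →
    ∀ (H : Config (N + 1) (Fin 3) T3 → ℝ≥0∞), Measurable H →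
    ∀ (s p q : ℝ), p.HolderConjugate q →
      ∫⁻ z, H (Φ.flow s z) ∂((liou σ N).withDensity ψ) ≤
        (∫⁻ z, (ψ (Φ.flow (-s) z) / ψ z) ^ p ∂((liou σ N).withDensity ψ)) ^ (1 / p) *
          (∫⁻ z, H z ^ q ∂((liou σ N).withDensity ψ)) ^ (1 / q)

/-- **Transport identity under a density** (steps (a)–(c) of the folklore argument): for a hard-sphere flow `Φ`
(Liouville-preserving), a measurable density `ψ` that is Liouville-a.e. nonzero and never `∞`, and a measurable
`H ≥ 0`, `∫ H (Φ_s z) d(ψL) = ∫ (ψ (Φ_{-s} w) / ψ w) · H w d(ψL)`. [folklore] -/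
theorem lintegral_comp_flow_withDensity_eq (σ : ℝ) (N : ℕ) (Φ : TFlow σ N)
    {ψ : Config (N + 1) (Fin 3) T3 → ℝ≥0∞} (hψ : Measurable ψ) (hψ0 : ∀ᵐ z ∂(liou σ N), ψ z ≠ 0)
    (hψtop : ∀ z, ψ z ≠ ∞) {H : Config (N + 1) (Fin 3) T3 → ℝ≥0∞} (hH : Measurable H) (s : ℝ) :
    ∫⁻ z, H (Φ.flow s z) ∂((liou σ N).withDensity ψ) =
      ∫⁻ w, ((fun w => ψ (Φ.flow (-s) w) / ψ w) * H) w ∂((liou σ N).withDensity ψ) := by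
  -- (a) pull the density out
  have hHs : Measurable fun z => H (Φ.flow s z) := hH.comp (Φ.measurable_flow s)
  rw [lintegral_withDensity_eq_lintegral_mul (liou σ N) hψ hHs]
  -- (b) on the good set `ψ z = ψ (Φ_{-s} (Φ_s z))`; then invariance of the Liouville measure
  have hG : Measurable fun w => ψ (Φ.flow (-s) w) * H w :=
    (hψ.comp (Φ.measurable_flow (-s))).mul hH
  have hae : (ψ * fun z => H (Φ.flow s z)) =ᵐ[liou σ N]
      fun z => ψ (Φ.flow (-s) (Φ.flow s z)) * H (Φ.flow s z) := by
    filter_upwards [Φ.ae_mem_good] with z hz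
    rw [Φ.flow_neg_flow s hz]
    rfl
  rw [lintegral_congr_ae hae, (Φ.measurePreserving s).lintegral_comp hG]
  -- (c) reinsert the density: `ψ (Φ_{-s} w) = ψ w * (ψ (Φ_{-s} w) / ψ w)` for `ψ w ≠ 0, ∞`
  have hRm : Measurable fun w => ψ (Φ.flow (-s) w) / ψ w :=
    (hψ.comp (Φ.measurable_flow (-s))).div hψ
  rw [lintegral_withDensity_eq_lintegral_mul (liou σ N) hψ (hRm.mul hH)]
  refine lintegral_congr_ae ?_
  filter_upwards [hψ0] with w hw
  simp only [Pi.mul_apply]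
  rw [← mul_assoc, ENNReal.mul_div_cancel hw (hψtop w)]

/-- **`stub_renyiHolderTransfer`** (registered helper stub of line `board-node-dock`, crux 9282): the Hölder transfer
`∫ H (Φ_s z) d(ψL) ≤ (∫ (ψ (Φ_{-s} z) / ψ z) ^ p d(ψL)) ^ {1/p} · (∫ H ^ q d(ψL)) ^ {1/q}` for conjugate `p, q`.
Transport identity `lintegral_comp_flow_withDensity_eq` + Hölder `ENNReal.lintegral_mul_le_Lp_mul_Lq`. [folklore] -/
theorem stub_renyiHolderTransfer : RenyiHolderTransfer := by
  intro σ N Φ ψ hψ hψ0 hψtop H hH s p q hpq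
  rw [lintegral_comp_flow_withDensity_eq σ N Φ hψ hψ0 hψtop hH s]
  have hRm : Measurable fun w => ψ (Φ.flow (-s) w) / ψ w :=
    (hψ.comp (Φ.measurable_flow (-s))).div hψ
  exact ENNReal.lintegral_mul_le_Lp_mul_Lq _ hpq hRm.aemeasurable hH.aemeasurable

end Summit.AtomisticToContinuum.HydrodynamicLimit.Theorems.KineticWindowGronwallRenyiHolderTransfer

end
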